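import Literature.NumberTheory.Automorphic.ClozelAlgebraicityConjugatesProofs
import Literature.FieldTheory.AlgClosed.AutComplexFiniteIndex
import HarnessLib

/-!
# Clozel's algebraicity fact, clause (i): finitely many `Aut(ℂ/E)`-conjugates give a number field

Proofs-only companion (theorems, no definitions, no named facts) of `ClozelAlgebraicity.lean`.
Clause (i) of `Clozel1990_regularAlgebraic` — `ℚ(π_f) = ratField π`, the fixed field of the
stabiliser `heckeStabilizer π ≤ Aut(ℂ)` of the unramified Hecke eigensystem, is finite over `ℚ` —
is proved in print through FINITENESS OF THE CONJUGATES: `π_f` is realised in the cuspidal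
cohomology `H•(S̃, Ṽ)`, which has an `E`-structure for a number field `E` (the field of
definition of the coefficient system), so for `σ ∈ Aut(ℂ/E)` the conjugate `^σπ_f` is again a
constituent of the same finite-dimensional space at the same level: the set
`{^σπ_f : σ ∈ Aut(ℂ/E)}` is finite, the stabiliser has finite index in `Aut(ℂ/E)`, and `ℚ(π_f)`
is a number field (Clozel 1990, §3.1 and the proof of Thm. 3.13 in §3.5; Shimura 1971, §6.8 for
the method). `ClozelAlgebraicityRatFieldProofs` formalised the parallel reduction "eigenvalues in a
number field ⟹ (i)"; this file formalises the orbit form on the tree's carriers: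

* `finiteIndex_heckeStabilizer_of_finite_conjugates` — if every `σ ∈ Aut(ℂ/E)` has a
  `σ`-conjugate of `π` at almost all places (`IsAutConjugate σ π π'`) inside a fixed finite set
  `S` of automorphic representations, then `heckeStabilizer π ∩ Aut(ℂ/E)` has finite index in
  `Aut(ℂ/E)` (two automorphisms with the same conjugate differ by an element of the stabiliser:
  the action laws `IsAutConjugate.trans/symm` and `mem_heckeStabilizer_iff_isAutConjugate`);
* **`finiteDimensional_ratField_of_finite_conjugates`** — hence `ratField π` is finite over `ℚ`
  (`Complex.finiteDimensional_fixedField_of_finiteIndex` of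
  `FieldTheory/AlgClosed/AutComplexFiniteIndex`: Artin's theorem for the finite group
  `Aut(ℂ/E)/N` acting on the fixed field of the normal core `N`, whose invariants are `E`).

The deep input — the finiteness of the set of conjugates, i.e. the cohomological realisation —
is the hypothesis; nothing is assumed about algebraicity of eigenvalues.

## References

* L. Clozel, *Motifs et formes automorphes: applications du principe de fonctorialité*, in
  Automorphic forms, Shimura varieties, and L-functions I (Ann Arbor 1988), Academic Press 1990,
  §3.1, Thm. 3.13 (i) and §3.5 [Clozel1990].
* G. Shimura, *Introduction to the arithmetic theory of automorphic functions* (1971), §6.8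
  [Shimura1971].
* S. Lang, *Algebra*, GTM 211 (2002), Ch. VI §1, Thm. 1.8 [Lang2002].
-/

noncomputable section

open scoped Classical
open NumberField IsDedekindDomain IntermediateField

namespace Literature.NumberTheory.Automorphic

variable {n : ℕ} {K : Type} [Field K] [NumberField K] {hcpt : isCompact_glFiniteIntegralLevel n K}

/-- **Finitely many conjugates ⟹ the stabiliser has finite index.** If for every `σ ∈ Aut(ℂ/E)`
(`E.fixingSubgroup`) some member of the finite set `S` is a `σ`-conjugate of `π` at almost all
places, then `heckeStabilizer π ∩ Aut(ℂ/E)` has finite index in `Aut(ℂ/E)`: if `σ, τ ∈ Aut(ℂ/E)`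
have the same conjugate `π'` then `π` is its own `τ⁻¹σ`-conjugate, i.e. `τ⁻¹σ ∈ heckeStabilizer π`,
so `Aut(ℂ/E)` is covered by at most `|S|` cosets. (Clozel 1990, §3.1: `Aut(ℂ)` acts on the
`π_f`'s, and `{σ : ^σπ_f ≅ π_f}` is the stabiliser.) [cite: Clozel1990, §3.1 and Thm. 3.13 (i)] -/
theorem finiteIndex_heckeStabilizer_of_finite_conjugates
    (π : AutomorphicRepData (AutomorphyDatum.gl n K hcpt)) (E : IntermediateField ℚ ℂ)
    (S : Finset (AutomorphicRepData (AutomorphyDatum.gl n K hcpt)))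
    (h : ∀ σ : ℂ ≃ₐ[ℚ] ℂ, σ ∈ E.fixingSubgroup →
      ∃ π' ∈ S, IsAutConjugate σ π π') :
    ((heckeStabilizer π ⊓ E.fixingSubgroup).subgroupOf E.fixingSubgroup).FiniteIndex := by
  set G : Subgroup (ℂ ≃ₐ[ℚ] ℂ) := E.fixingSubgroup with hG_def
  set K₀ : Subgroup G := (heckeStabilizer π ⊓ G).subgroupOf G with hK₀_def
  -- the conjugate `c σ ∈ S` of `π` chosen for each `σ ∈ G`
  have hc : ∀ σ : G, ∃ π' ∈ S, IsAutConjugate (σ : ℂ ≃ₐ[ℚ] ℂ) π π' := fun σ ↦ h σ σ.2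
  choose c hcS hcπ using hc
  -- automorphisms with the same conjugate lie in the same coset of `K₀`
  have key : ∀ σ τ : G, c σ = c τ → (QuotientGroup.mk σ : G ⧸ K₀) = QuotientGroup.mk τ := by
    intro σ τ hστ
    rw [QuotientGroup.eq, hK₀_def, Subgroup.mem_subgroupOf]
    refine Subgroup.mem_inf.mpr ⟨?_, (σ⁻¹ * τ).2⟩
    rw [mem_heckeStabilizer_iff_isAutConjugate]
    have hσ : IsAutConjugate (σ : ℂ ≃ₐ[ℚ] ℂ) π (c τ) := hστ ▸ hcπ σ
    exact (hcπ τ).trans hσ.symm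
  -- `G ⧸ K₀` is the image of the finite set of conjugates actually occurring
  let T := {s : AutomorphicRepData (AutomorphyDatum.gl n K hcpt) // ∃ σ : G, c σ = s}
  haveI : Finite T := by
    refine Finite.of_injective (fun t : T ↦ (⟨t.1, ?_⟩ : S)) fun t t' htt' ↦ Subtype.ext ?_
    · obtain ⟨σ, hσ⟩ := t.2
      exact hσ ▸ hcS σ
    · exact congrArg (fun s : S ↦ (s : AutomorphicRepData (AutomorphyDatum.gl n K hcpt))) htt'
  have hsurj : Function.Surjective fun t : T ↦ (QuotientGroup.mk t.2.choose : G ⧸ K₀) := by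
    intro x
    induction x using QuotientGroup.induction_on with
    | H σ =>
      refine ⟨⟨c σ, σ, rfl⟩, key _ _ ?_⟩
      exact (⟨c σ, σ, rfl⟩ : T).2.choose_spec
  haveI : Finite (G ⧸ K₀) := Finite.of_surjective _ hsurj
  exact Subgroup.finiteIndex_of_finite_quotient

/-- **Clause (i) of Clozel's theorem from the finiteness of the conjugates.** If, for some subfield
`E ⊆ ℂ` finite over `ℚ` and some finite set `S` of automorphic representations of `GL_n(𝔸_K)`,
every `σ ∈ Aut(ℂ/E)` admits a `σ`-conjugate of `π` at almost all places inside `S` — in print: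
`^σπ_f`, `σ ∈ Aut(ℂ/E)`, runs through the finitely many constituents of the cuspidal cohomology
of a fixed level with coefficients in the `E`-rational local system `Ṽ = ^σṼ` (Clozel 1990, §3.5)
— then the rationality field `ℚ(π_f) = ratField π` is finite over `ℚ`: the stabiliser has finite
index in `Aut(ℂ/E)` (`finiteIndex_heckeStabilizer_of_finite_conjugates`) and a subgroup of
`Aut(ℂ)` of finite index in `Aut(ℂ/E)` has a fixed field finite over `ℚ`
(`Complex.finiteDimensional_fixedField_of_finiteIndex`, Artin). Clozel 1990, Thm. 3.13 (i):
"`ℚ(π_f)` est une extension finie de `ℚ`". [cite: Clozel1990, Thm. 3.13 (i), proof §3.5] -/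
theorem finiteDimensional_ratField_of_finite_conjugates
    (π : AutomorphicRepData (AutomorphyDatum.gl n K hcpt)) (E : IntermediateField ℚ ℂ)
    [FiniteDimensional ℚ E] (S : Finset (AutomorphicRepData (AutomorphyDatum.gl n K hcpt)))
    (h : ∀ σ : ℂ ≃ₐ[ℚ] ℂ, σ ∈ E.fixingSubgroup →
      ∃ π' ∈ S, IsAutConjugate σ π π') :
    FiniteDimensional ℚ (ratField π) :=
  Literature.FieldTheory.AlgClosed.Complex.finiteDimensional_fixedField_of_finiteIndex
    (heckeStabilizer π) E (finiteIndex_heckeStabilizer_of_finite_conjugates π E S h)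

/-- The same with the hypothesis phrased for CUSPIDAL conjugates (the shape of clause (ii) of
`Clozel1990_regularAlgebraic`): finitely many cuspidal `Aut(ℂ/E)`-conjugates ⟹ `ℚ(π_f)` is a
number field. [cite: Clozel1990, Thm. 3.13 (i)] -/
theorem CuspidalAutomorphicRepData.finiteDimensional_ratField_of_finite_conjugates
    (π : CuspidalAutomorphicRepData n K hcpt) (E : IntermediateField ℚ ℂ) [FiniteDimensional ℚ E]
    (S : Finset (CuspidalAutomorphicRepData n K hcpt))
    (h : ∀ σ : ℂ ≃ₐ[ℚ] ℂ, σ ∈ E.fixingSubgroup →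
      ∃ π' ∈ S, IsAutConjugate σ π.1 π'.1) :
    FiniteDimensional ℚ (ratField π.1) := by
  refine Literature.NumberTheory.Automorphic.finiteDimensional_ratField_of_finite_conjugates π.1 E
    (S.image fun π' : CuspidalAutomorphicRepData n K hcpt ↦ π'.1) fun σ hσ ↦ ?_
  obtain ⟨π', hπ', hc⟩ := h σ hσ
  exact ⟨π'.1, Finset.mem_image_of_mem _ hπ', hc⟩

end Literature.NumberTheory.Automorphic
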